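import Literature.Barriers.BirchSwinnertonDyer.PAdicFunctionalEquationParityProofs

/-!
# Parity of `ord_{T=0} L_p(E,T)` is the same at every good ordinary prime — any level, `p = 2` included

For the newform `f ∈ S₂(Γ₀(N))` (ANY level `N`) of an elliptic `W/ℚ` and a good ordinary prime `p`
(any `p`, also `2`), the tree's parity-free functional equation
`padicLFunction_mem_padicFEClass_neg_frickeEigenvalue` reads `L_p(E, T^ι) = σ (1+T)^c L_p(E, T)` with
the SAME sign `σ = -ε(f) ∈ {±1}` at every `p` (the Fricke sign of `f` does not see `p`). Comparing
leading coefficients (`eq_neg_one_pow_of_subst_eq`) gives `σ = (-1)^{ord_{T=0} L_p(E,T)}` in `ℚ_p`,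
hence: **the parity of `ord_{T=0} L_p(E,T)` is `[σ = 1]`, independent of the good ordinary prime `p`**
(`even_order_padicLFunction_iff_even_order`). No Carayol (level `=` conductor), no root number, no
`p ≠ 2`. (Crux stmt-BirchSwinnertonDyer-0490, line `Sketch`, lead c4: transfers `ord ≡ rank (mod 2)`
from an odd good ordinary prime, where the route items give `ord = rank`, to `p = 2`.)

References: B. Mazur, J. Tate, J. Teitelbaum, Invent. Math. 84 (1986), §I.17; R. Greenberg, LNM 1716
(1999), §1 (pp. 67–68), §5 (p. 181).
-/

noncomputable section

namespace Literature.Barriers.BirchSwinnertonDyer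

open scoped MatrixGroups ModularForm
open PowerSeries CongruenceSubgroup WeierstrassCurve Literature.NumberTheory.EllipticCurves
  Literature.NumberTheory.EllipticCurves.ModularForms

variable {N : ℕ} [NeZero N] {f : CuspForm (Gamma0 N) 2}
  {W : WeierstrassCurve ℚ} [W.IsGloballyMinimal] [W.IsElliptic]

/-- **The `p`-adic sign is `-ε(f)` at every good ordinary prime and every level.** For the newform
`f ∈ S₂(Γ₀(N))` of `W` and `p` good ordinary (any `p`): the integer `σ ∈ {±1}` with `σ = -ε(f)`
satisfies `σ = (-1)^{ord_{T=0} L_p(E,T)}` in `ℚ_p` (functional equation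
`padicLFunction_mem_padicFEClass_neg_frickeEigenvalue`, finiteness of the order by Rohrlich
`padicLFunction_ne_zero_holds`, leading coefficients `eq_neg_one_pow_of_subst_eq`).
[cite: GreenbergLNM1716, §1 (functional equation, pp. 67–68) and §5 (p. 181)] -/
theorem exists_frickeSign_eq_neg_one_pow_order_padicLFunction {p : ℕ} [Fact p.Prime]
    (hord : IsOrdinaryAt W p) (hf : IsNewformOf W f) :
    ∃ σ : ℤ, (σ = 1 ∨ σ = -1) ∧ (σ : ℂ) = -frickeEigenvalue f ∧
      ((σ : ℤ) : ℚ_[p]) = (-1) ^ (padicLFunction f (unitRoot W p : ℚ_[p])).order.toNat := by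
  obtain ⟨σ, hσ, hσε, u, hu, hFE⟩ := padicLFunction_mem_padicFEClass_neg_frickeEigenvalue hord hf
  have h0 : padicLFunction f (unitRoot W p : ℚ_[p]) ≠ 0 := padicLFunction_ne_zero_holds hord hf
  exact ⟨σ, hσ, hσε, eq_neg_one_pow_of_subst_eq constantCoeff_invOnePlusSubOne
    coeff_one_invOnePlusSubOne (binomialMultipliers_subset_principalUnits p hu) hFE
    (coe_toNat_order h0).symm⟩

/-- **`ord_{T=0} L_p(E,T)` is even iff `ε(f) = -1`**, at every good ordinary prime `p` (also `2`) and
every level. [cite: GreenbergLNM1716, §5 (p. 181, `λ_E^{anal} = 1` passage)] -/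
theorem even_order_padicLFunction_iff_frickeEigenvalue_eq_neg_one {p : ℕ} [Fact p.Prime]
    (hord : IsOrdinaryAt W p) (hf : IsNewformOf W f) :
    Even (padicLFunction f (unitRoot W p : ℚ_[p])).order.toNat ↔ frickeEigenvalue f = -1 := by
  obtain ⟨σ, hσ, hσε, hsign⟩ := exists_frickeSign_eq_neg_one_pow_order_padicLFunction hord hf
  set n := (padicLFunction f (unitRoot W p : ℚ_[p])).order.toNat with hn
  constructor
  · intro heven
    rw [heven.neg_one_pow] at hsign
    have hσ1 : σ = 1 := by exact_mod_cast hsign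
    rw [hσ1] at hσε
    push_cast at hσε
    linear_combination hσε
  · intro hε
    have hσ1 : σ = 1 := by
      have h : (σ : ℂ) = 1 := by rw [hσε, hε]; norm_num
      exact_mod_cast h
    rw [hσ1] at hsign
    push_cast at hsign
    by_contra hodd
    rw [Nat.not_even_iff_odd] at hodd
    rw [hodd.neg_one_pow] at hsign
    norm_num at hsign

/-- **Parity transfer.** For the newform `f` (any level) of `W` and two good ordinary primes `p, q`
(any, also `2`): `ord_{T=0} L_p(E,T)` and `ord_{T=0} L_q(E,T)` have the same parity (both are even
iff `ε(f) = -1`). [cite: GreenbergLNM1716, §5 (p. 181, `λ_E^{anal} = 1` passage)] -/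
theorem even_order_padicLFunction_iff_even_order {p q : ℕ} [Fact p.Prime] [Fact q.Prime]
    (hp : IsOrdinaryAt W p) (hq : IsOrdinaryAt W q) (hf : IsNewformOf W f) :
    Even (padicLFunction f (unitRoot W p : ℚ_[p])).order.toNat ↔
      Even (padicLFunction f (unitRoot W q : ℚ_[q])).order.toNat := by
  rw [even_order_padicLFunction_iff_frickeEigenvalue_eq_neg_one hp hf,
    even_order_padicLFunction_iff_frickeEigenvalue_eq_neg_one hq hf]

/-- **Order transfer modulo 2, with finite orders.** Same hypotheses; if `ord_{T=0} L_q(E,T) = r`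
then `ord_{T=0} L_p(E,T) = m` for a natural number `m ≡ r (mod 2)` (the order at `p` is finite by
Rohrlich). [cite: GreenbergLNM1716, §5 (p. 181, `λ_E^{anal} = 1` passage)] -/
theorem exists_order_padicLFunction_eq_and_even_iff {p q : ℕ} [Fact p.Prime] [Fact q.Prime]
    (hp : IsOrdinaryAt W p) (hq : IsOrdinaryAt W q) (hf : IsNewformOf W f) {r : ℕ}
    (hr : (padicLFunction f (unitRoot W q : ℚ_[q])).order = r) :
    ∃ m : ℕ, (padicLFunction f (unitRoot W p : ℚ_[p])).order = m ∧ (Even m ↔ Even r) := by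
  have h0 : padicLFunction f (unitRoot W p : ℚ_[p]) ≠ 0 := padicLFunction_ne_zero_holds hp hf
  refine ⟨(padicLFunction f (unitRoot W p : ℚ_[p])).order.toNat, (coe_toNat_order h0).symm, ?_⟩
  rw [even_order_padicLFunction_iff_even_order hp hq hf, hr]
  simp

end Literature.Barriers.BirchSwinnertonDyer

end
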